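import Mathlib
import HarnessLib

/-!
# Crux `GrenetZeon.PolySizeQPAlgebra` (stmt-ValiantsHypothesis-8064), line `vbp-slice-dealg` —
# rank bricks for the residual-corank-two case of the type-independent local Hessian bound

After the normal form `A(p) ≃ diag(1_k, S)` (`S` a `2 × 2` matrix over the maximal ideal, `det S = 0`)
the Hessian of the read-out `F = λ(det A)` at `p` splits (memo `evidence-8064-leafhand6-g2.md`) as
`T₃ + T₄ + (T₁ + T₂ + T₅)` with, writing `X_s = ∂_s A` in blocks,
`T₃(s,t) = -λ(tr(adj S · X₂₁(s) X₁₂(t)))`, `T₄` its mirror, and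
`(T₁+T₂+T₅)(s,t) = λ(τ_s ζ_t + τ_t ζ_s + β(Z_s, Z_t))`, `τ_s = tr X₁₁(s)`, `Z_s = X₂₂(s)`,
`ζ_s = tr(adj S · Z_s)`, `β(Z, W) = tr(adj Z · W)` (the polarised `2 × 2` determinant).  This file
proves the three rank bounds that turn this into `rank Hess F(p) ≤ k(ℓ Col adj S + ℓ Row adj S) + 4 dim R`
(whence `≤ 2 · dim R · n` by `AL(2)`, file `…AdjugateLengthTwo`):

* `rank_linear_readOut_le` — a matrix `(s, t) ↦ φ_t(w_s)` with `w_s` in a `ℂ`-space `V` and `φ_t` linear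
  functionals has rank `≤ dim V` (it factors through `V`); `rank_linear_readOut_le'` — the mirror.
* `rank_dotProduct_mulVec_readOut_le` — `(s, t) ↦ λ(x_s · (M y_t))` has rank `≤ dim_ℂ Col(M)`
  (the bound `ℓ(Col adj S)` per column index for `T₃`; `T₄` by the mirror).
* `rank_symmetrised_fin_two_form_le` — **the graph lemma**: for `det S = 0`,
  `(s,t) ↦ λ(τ_s ζ_t + τ_t ζ_s + β(Z_s, Z_t))` has rank `≤ 4 · dim R` (not `5 · dim R`): with
  `W_s = τ_s S + Z_s` it equals `λ(β(W_s, Z_t) + τ_t β(S, W_s))`, linear in `W_s ∈ Mat_2(R)`, because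
  `β(S, S) = 2 det S = 0`.

HONEST FRAMING: linear algebra bricks; no stub of the line is closed; VP ≠ VNP is not moved.

References: T. Mignon, N. Ressayre, IMRN 2004:79, §2 [MignonRessayre2004].
-/

noncomputable section

open Matrix

-- single-conjunct layout `Summits/ValiantsHypothesis/ValiantsHypothesis`: duplicated namespace by design
set_option linter.dupNamespace false

namespace Summit.ValiantsHypothesis.ValiantsHypothesis.Theorems.GrenetZeonPolySizeQPAlgebra

section Factor

variable {σ : Type*} [Fintype σ] {V : Type*} [AddCommGroup V] [Module ℂ V] [Module.Finite ℂ V]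

/-- A matrix `(s, t) ↦ φ_t(w_s)` (`w : σ → V`, `φ_t` linear functionals on a finite-dimensional
`ℂ`-space `V`) factors through `V`, hence has rank `≤ dim V`. [folklore] -/
theorem rank_linear_readOut_le (w : σ → V) (φ : σ → (V →ₗ[ℂ] ℂ)) :
    (Matrix.of fun s t => φ t (w s)).rank ≤ Module.finrank ℂ V := by
  classical
  set b := Module.finBasis ℂ V with hb
  set P : Matrix σ (Fin (Module.finrank ℂ V)) ℂ := Matrix.of fun s j => b.repr (w s) j with hP
  set Q : Matrix (Fin (Module.finrank ℂ V)) σ ℂ := Matrix.of fun j t => φ t (b j) with hQ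
  have hPQ : (Matrix.of fun s t => φ t (w s)) = P * Q := by
    ext s t
    rw [Matrix.mul_apply]
    simp only [hP, hQ, Matrix.of_apply]
    conv_lhs => rw [← b.sum_repr (w s)]
    rw [map_sum]
    refine Finset.sum_congr rfl fun j _ => ?_
    rw [map_smul, smul_eq_mul]
  rw [hPQ]
  exact (Matrix.rank_mul_le_right P Q).trans
    ((Matrix.rank_le_card_height Q).trans (Fintype.card_fin _).le)

/-- Mirror form: `(s, t) ↦ φ_s(w_t)` has rank `≤ dim V`. [folklore] -/
theorem rank_linear_readOut_le' (w : σ → V) (φ : σ → (V →ₗ[ℂ] ℂ)) :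
    (Matrix.of fun s t => φ s (w t)).rank ≤ Module.finrank ℂ V := by
  have h : (Matrix.of fun s t => φ s (w t)) = (Matrix.of fun s t => φ t (w s))ᵀ := by
    ext s t; rfl
  rw [h, Matrix.rank_transpose]
  exact rank_linear_readOut_le w φ

end Factor

section Bricks

variable {σ : Type*} [Fintype σ] {R : Type*} [CommRing R] [Algebra ℂ R] [Module.Finite ℂ R]

/-- **Brick for `T₃`, `T₄`.**  For `x, y : σ → Rᵐ` and a square matrix `M` over `R`, the matrix
`(s, t) ↦ λ(x_s · (M y_t))` has rank at most the `ℂ`-dimension of the column module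
`Col(M) = range(v ↦ M v)`: it factors through `t ↦ M y_t ∈ Col(M)`. [folklore] -/
theorem rank_dotProduct_mulVec_readOut_le {m : ℕ} (l : R →ₗ[ℂ] ℂ) (M : Matrix (Fin m) (Fin m) R)
    (x y : σ → Fin m → R) :
    (Matrix.of fun s t => l (x s ⬝ᵥ M.mulVec (y t))).rank ≤
      Module.finrank ℂ (LinearMap.range (M.mulVecLin.restrictScalars ℂ)) := by
  set N : Submodule ℂ (Fin m → R) := LinearMap.range (M.mulVecLin.restrictScalars ℂ) with hN
  have hmem : ∀ t, M.mulVec (y t) ∈ N := fun t => ⟨y t, rfl⟩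
  set w : σ → N := fun t => ⟨M.mulVec (y t), hmem t⟩ with hw
  -- the functionals `v ↦ λ(x_s · v)` restricted to `N`
  set φ : σ → (N →ₗ[ℂ] ℂ) := fun s =>
    l ∘ₗ ((LinearMap.restrictScalars ℂ
      ((dotProductBilin R R (x s) : (Fin m → R) →ₗ[R] R))) ∘ₗ N.subtype) with hφ
  have h : (Matrix.of fun s t => l (x s ⬝ᵥ M.mulVec (y t))) = Matrix.of fun s t => φ s (w t) := by
    ext s t
    simp [hφ, hw]
  rw [h]
  exact rank_linear_readOut_le' w φ

/-- **The graph lemma (brick for `T₁ + T₂ + T₅`).**  Let `S` be a `2 × 2` matrix over `R` with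
`det S = 0`, `τ : σ → R`, `Z : σ → Mat_2(R)`, and `β(Z, W) = tr(adj Z · W)` the polarised `2 × 2`
determinant, `ζ_s = β(S, Z_s)`.  Then `(s, t) ↦ λ(τ_s ζ_t + τ_t ζ_s + β(Z_s, Z_t))` has rank
`≤ 4 · dim R`: with `W_s = τ_s S + Z_s` the entry is `λ(β(W_s, Z_t) + τ_t β(S, W_s))` (as
`β(S, S) = 2 det S = 0`), linear in `W_s ∈ Mat_2(R) ≅ ℂ^{4 dim R}`. [folklore] -/
theorem rank_symmetrised_fin_two_form_le (l : R →ₗ[ℂ] ℂ) (S : Matrix (Fin 2) (Fin 2) R)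
    (hS : S.det = 0) (τ : σ → R) (Z : σ → Matrix (Fin 2) (Fin 2) R) :
    (Matrix.of fun s t => l (τ s * (S.adjugate * Z t).trace + τ t * (S.adjugate * Z s).trace +
      ((Z s).adjugate * Z t).trace)).rank ≤ 4 * Module.finrank ℂ R := by
  classical
  -- adjugate is additive and homogeneous on `2 × 2` matrices
  have hadj_add : ∀ A B : Matrix (Fin 2) (Fin 2) R, (A + B).adjugate = A.adjugate + B.adjugate := by
    intro A B
    rw [Matrix.adjugate_fin_two, Matrix.adjugate_fin_two, Matrix.adjugate_fin_two]
    ext i j; fin_cases i <;> fin_cases j <;> simp [add_comm]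
  have hadj_smul : ∀ (c : R) (A : Matrix (Fin 2) (Fin 2) R), (c • A).adjugate = c • A.adjugate := by
    intro c A
    rw [Matrix.adjugate_fin_two, Matrix.adjugate_fin_two]
    ext i j; fin_cases i <;> fin_cases j <;> simp
  have htrSS : (S.adjugate * S).trace = 0 := by
    rw [Matrix.adjugate_mul, Matrix.trace_smul, hS, zero_smul]
  -- the functionals `W ↦ λ(tr(adj W · Z_t) + τ_t tr(adj S · W))`, `ℂ`-linear in `W`
  have hlin : ∀ (t : σ) (c : R) (A B : Matrix (Fin 2) (Fin 2) R),
      ((c • A + B).adjugate * Z t).trace + τ t * (S.adjugate * (c • A + B)).trace =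
        c * ((A.adjugate * Z t).trace + τ t * (S.adjugate * A).trace) +
          ((B.adjugate * Z t).trace + τ t * (S.adjugate * B).trace) := by
    intro t c A B
    rw [hadj_add, hadj_smul, Matrix.add_mul, Matrix.smul_mul, Matrix.trace_add, Matrix.trace_smul,
      Matrix.mul_add, Matrix.mul_smul, Matrix.trace_add, Matrix.trace_smul, smul_eq_mul, smul_eq_mul]
    ring
  let ψ : σ → (Matrix (Fin 2) (Fin 2) R →ₗ[ℂ] ℂ) := fun t =>
    { toFun := fun A => l ((A.adjugate * Z t).trace + τ t * (S.adjugate * A).trace)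
      map_add' := fun A B => by
        have h := hlin t 1 A B
        rw [one_smul, one_mul] at h
        rw [h, map_add]
      map_smul' := fun c A => by
        have h := hlin t (algebraMap ℂ R c) A 0
        rw [add_zero, algebraMap_smul] at h
        rw [RingHom.id_apply, h]
        simp only [Matrix.adjugate_zero, Matrix.zero_mul, Matrix.trace_zero, mul_zero, add_zero]
        rw [← Algebra.smul_def, map_smul] }
  -- the graph identity: entry `(s, t)` is `ψ_t (τ_s S + Z_s)`
  have hentry : ∀ s t, l (τ s * (S.adjugate * Z t).trace + τ t * (S.adjugate * Z s).trace +
      ((Z s).adjugate * Z t).trace) = ψ t (τ s • S + Z s) := by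
    intro s t
    show _ = l (((τ s • S + Z s).adjugate * Z t).trace + τ t * (S.adjugate * (τ s • S + Z s)).trace)
    rw [hlin t (τ s) S (Z s), htrSS]
    congr 1
    ring
  have h : (Matrix.of fun s t => l (τ s * (S.adjugate * Z t).trace +
      τ t * (S.adjugate * Z s).trace + ((Z s).adjugate * Z t).trace)) =
      Matrix.of fun s t => ψ t ((fun s => τ s • S + Z s) s) := by
    ext s t
    exact hentry s t
  rw [h]
  refine (rank_linear_readOut_le (fun s => τ s • S + Z s) ψ).trans ?_
  rw [Module.finrank_matrix ℂ R (Fin 2) (Fin 2), Fintype.card_fin]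

end Bricks

end Summit.ValiantsHypothesis.ValiantsHypothesis.Theorems.GrenetZeonPolySizeQPAlgebra

end
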